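import Summits.AtomisticToContinuum.FouriersLaw.Theorems.PhononMeanFreePathDefs
import Summits.AtomisticToContinuum.FouriersLaw.Theorems.PhononMeanFreePathCoherentDephasingWeakCouplingCorrelationDecay
import Summits.AtomisticToContinuum.FouriersLaw.Theorems.BondHeatUncertaintySubdiffusiveBondHeatSiteEnergyDynkinTruncation
import Summits.AtomisticToContinuum.FouriersLaw.Theorems.BondHeatUncertaintySubdiffusiveBondHeatBathBondReductionDynkin

/-!
# `CoherentDephasing` / line `Sketch`: Duhamel's formula for the kick response (Dynkin paired with `p₀`)

Support file 1/3 for stub `stub_meanFieldDuhamel` of line `Sketch` (coherent-field Beer–Lambert) of crux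
`stmt-AtomisticToContinuum-11810` (`PhononMeanFreePath.CoherentDephasing`). For the `(N+1)`-site pinned anharmonic
chain `P = pinnedChain ω₂ lam β γ` with both Langevin baths at `T > 0`, Gibbs law `μ_T = P.gibbsMeasure (N+1) T`,
constructed kernels `K_t = P.transitionKernel (N+1) T T t⁺` and the kick response
`kickResp … g t = ∫ p₀ · (K_t g) dμ_T` (`Theorems/PhononMeanFreePathDefs`), the registered sub-goal `kickResp_duhamel`:

  `kickResp e t - ∫ p₀ e dμ_T = ∫₀ᵗ kickResp (L e) s ds`     (`t ≥ 0`)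

for every `C²` observable `e` of linear energy growth (`|e| ≤ C(1+H)`, bounded bath-momentum derivatives
`∂_{p₀} e`, `∂_{p_N} e`) whose generator image `L e = ℓ` is continuous with `|ℓ| ≤ B (1+H)²` — the class containing
the coordinates `q_x`, `p_x`. Ingredients (all in the tree): Dynkin's identity for `C²_c` observables extended by the
truncations `e χ(H/R)` (`pinnedChain_dynkin_of_truncation`, `generator_mul_smoothCutoff_hamiltonian`, CEHR (3.4)), with
the truncation error `|L(eχ_R) - χ_R Le| ≤ (A/R)(1+H)²` proved here for the whole class; and the pairing of pointwise
Dynkin against `p₀ ∈ L²(μ_T)` under the `K_t`-invariant law `μ_T` (`pinnedChain_integral_mul_act_sub_of_dynkin`,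
`pinnedChain_gibbsMeasure_bind_transitionKernel`). Nothing here closes an item.
-/

noncomputable section

open MeasureTheory ProbabilityTheory Filter Topology Set
open scoped NNReal ENNReal

namespace Summit.AtomisticToContinuum.FouriersLaw.Theorems.CoherentDephasing.MeanFieldDuhamel

open Literature.MathematicalPhysics.KineticTheory.HeatConduction
open Literature.MathematicalPhysics.KineticTheory Literature.Probability.Process OscillatorChain
open Summit.AtomisticToContinuum.FouriersLaw.Theorems.SubdiffusiveBondHeat
open Summit.AtomisticToContinuum.FouriersLaw.Theorems.PhononMeanFreePath

/-! ### The truncation error `L(e χ_R) - χ_R L e` for an observable of linear energy growth -/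

section TruncError

variable {ω₂ lam β γ : ℝ}

/-- **Truncation error.** For the pinned chain (`ω₂, lam, β, γ ≥ 0`, `n ≥ 1` sites, equal bath temperatures
`T ≥ 0`), a `C²` observable `e` with `|e| ≤ C_e (1+H)` and `|∂_{p₀} e|, |∂_{p_{n-1}} e| ≤ D`, there is `A ≥ 0` with
`|L(e χ(H/R)) - χ(H/R) L e| ≤ (A/R)(1+H)²` for all `R ≥ 1` (`χ = smoothCutoff`): by
`generator_mul_smoothCutoff_hamiltonian` the difference is `e Lχ_R + Γ(e, χ_R)`, every term of which carries a factor
`γ/R` and is quadratic in `(1+H)` (`|χ'|, |χ''|` bounded, `p_b² ≤ 2H`, `|p_b| ≤ 1 + H`). [folklore] -/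
theorem pinnedChain_abs_generator_trunc_sub_le (hω : 0 ≤ ω₂) (hl : 0 ≤ lam) (hβ : 0 ≤ β) (hγ : 0 ≤ γ)
    {n : ℕ} (hn : 0 < n) {T : ℝ} (hT : 0 ≤ T) {e : PhaseSpace n → ℝ} (he : ContDiff ℝ 2 e)
    {Ce D : ℝ} (hCe : 0 ≤ Ce) (hD : 0 ≤ D)
    (heb : ∀ y, |e y| ≤ Ce * (1 + (pinnedChain ω₂ lam β γ).hamiltonian n y))
    (hd0 : ∀ y, |partialP ⟨0, hn⟩ e y| ≤ D)
    (hdN : ∀ y, |partialP ⟨n - 1, Nat.sub_lt hn one_pos⟩ e y| ≤ D) :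
    ∃ A : ℝ, 0 ≤ A ∧ ∀ R : ℝ, 1 ≤ R → ∀ x : PhaseSpace n,
      |(pinnedChain ω₂ lam β γ).generator n T T
            (fun y => e y * smoothCutoff ((pinnedChain ω₂ lam β γ).hamiltonian n y / R)) x -
          smoothCutoff ((pinnedChain ω₂ lam β γ).hamiltonian n x / R) *
            (pinnedChain ω₂ lam β γ).generator n T T e x| ≤
        A / R * (1 + (pinnedChain ω₂ lam β γ).hamiltonian n x) ^ 2 := by
  obtain ⟨M₁, hM₁0, hM₁⟩ := exists_bound_deriv_smoothCutoff
  obtain ⟨M₂, hM₂0, hM₂⟩ := exists_bound_deriv_deriv_smoothCutoff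
  refine ⟨γ * (Ce * (M₁ * (2 * T + 4) + 4 * M₂ * T) + 4 * M₁ * T * D), by positivity, fun R hR x => ?_⟩
  have hR0 : 0 < R := lt_of_lt_of_le one_pos hR
  have hTγ : 0 ≤ (pinnedChain ω₂ lam β γ).γ * T := mul_nonneg hγ hT
  have hU2 : ContDiff ℝ 2 (pinnedChain ω₂ lam β γ).U := pinnedChain_contDiff_U ω₂ lam β γ
  have hV2 : ContDiff ℝ 2 (pinnedChain ω₂ lam β γ).V := pinnedChain_contDiff_V ω₂ lam β γ
  have hγ' : (pinnedChain ω₂ lam β γ).γ = γ := rfl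
  rw [generator_mul_smoothCutoff_hamiltonian hU2 hV2 hn hTγ hTγ he R x, hγ', add_sub_cancel_left]
  -- elementary bounds
  have hH0 : 0 ≤ (pinnedChain ω₂ lam β γ).hamiltonian n x := pinnedChain_hamiltonian_nonneg hω hl hβ γ n x
  have hU0 : ∀ q, 0 ≤ (pinnedChain ω₂ lam β γ).U q := fun q => by
    show 0 ≤ ω₂ * q ^ 2 / 2 + lam * q ^ 4 / 4; positivity
  have hV0 : ∀ r, 0 ≤ (pinnedChain ω₂ lam β γ).V r := fun r => by
    show 0 ≤ r ^ 2 / 2 + β * r ^ 4 / 4; positivity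
  have hp2 : ∀ i : Fin n, x.2 i ^ 2 ≤ 2 * (pinnedChain ω₂ lam β γ).hamiltonian n x := fun i => by
    have h1 := (pinnedChain ω₂ lam β γ).site_le_hamiltonian hU0 hV0 n x i
    have h2 := hU0 (x.1 i)
    linarith
  have hpa : ∀ i : Fin n, |x.2 i| ≤ 1 + (pinnedChain ω₂ lam β γ).hamiltonian n x := fun i => by
    have h1 := abs_le_half_one_add_sq (x.2 i)
    have h2 := hp2 i
    linarith
  have hE := heb x
  have ha := hd0 x
  have hb := hdN x
  have hpp := hp2 ⟨0, hn⟩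
  have hqq := hp2 ⟨n - 1, Nat.sub_lt hn one_pos⟩
  have hpa' := hpa ⟨0, hn⟩
  have hqa' := hpa ⟨n - 1, Nat.sub_lt hn one_pos⟩
  have hχ₁b := hM₁ ((pinnedChain ω₂ lam β γ).hamiltonian n x / R)
  have hχ₂b := hM₂ ((pinnedChain ω₂ lam β γ).hamiltonian n x / R)
  -- make the atoms opaque
  generalize deriv smoothCutoff ((pinnedChain ω₂ lam β γ).hamiltonian n x / R) = χ₁ at hχ₁b ⊢
  generalize deriv (deriv smoothCutoff) ((pinnedChain ω₂ lam β γ).hamiltonian n x / R) = χ₂ at hχ₂b ⊢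
  generalize e x = E at hE ⊢
  generalize partialP ⟨0, hn⟩ e x = a at ha ⊢
  generalize partialP ⟨n - 1, Nat.sub_lt hn one_pos⟩ e x = b at hb ⊢
  generalize (pinnedChain ω₂ lam β γ).hamiltonian n x = Hx at hH0 hE hpp hqq hpa' hqa' ⊢
  generalize x.2 ⟨0, hn⟩ = p at hpp hpa' ⊢
  generalize x.2 ⟨n - 1, Nat.sub_lt hn one_pos⟩ = q at hqq hqa' ⊢
  -- real arithmetic: everything carries a factor `γ/R`
  have key : E * (γ * (χ₁ / R * (T + T - p ^ 2 - q ^ 2) + χ₂ / R ^ 2 * (T * p ^ 2 + T * q ^ 2))) +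
      χ₁ / R * (2 * γ * T * p * a + 2 * γ * T * q * b) =
      γ / R * (E * (χ₁ * (2 * T - p ^ 2 - q ^ 2) + χ₂ * T * (p ^ 2 + q ^ 2) / R) +
        χ₁ * (2 * T) * (p * a + q * b)) := by
    field_simp; ring
  have h1 : |χ₁ * (2 * T - p ^ 2 - q ^ 2)| ≤ M₁ * (2 * T + p ^ 2 + q ^ 2) := by
    rw [abs_mul]
    refine mul_le_mul hχ₁b ?_ (abs_nonneg _) hM₁0
    have := sq_nonneg p
    have := sq_nonneg q
    rw [abs_le]; constructor <;> linarith
  have h2 : |χ₂ * T * (p ^ 2 + q ^ 2) / R| ≤ M₂ * T * (p ^ 2 + q ^ 2) := by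
    have hb0 : 0 ≤ p ^ 2 + q ^ 2 := by positivity
    rw [abs_div, abs_mul, abs_mul, abs_of_nonneg hT, abs_of_nonneg hb0, abs_of_pos hR0]
    calc |χ₂| * T * (p ^ 2 + q ^ 2) / R ≤ |χ₂| * T * (p ^ 2 + q ^ 2) / 1 :=
          div_le_div_of_nonneg_left (by positivity) one_pos hR
      _ ≤ M₂ * T * (p ^ 2 + q ^ 2) := by
          rw [div_one]
          exact mul_le_mul_of_nonneg_right (mul_le_mul_of_nonneg_right hχ₂b hT) hb0
  have h3 : |χ₁ * (2 * T) * (p * a + q * b)| ≤ M₁ * (2 * T) * (D * (1 + Hx) + D * (1 + Hx)) := by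
    rw [abs_mul, abs_mul, abs_of_nonneg (by positivity : (0:ℝ) ≤ 2 * T)]
    have hpq : |p * a + q * b| ≤ D * (1 + Hx) + D * (1 + Hx) := by
      calc |p * a + q * b| ≤ |p * a| + |q * b| := abs_add_le _ _
        _ = |p| * |a| + |q| * |b| := by rw [abs_mul, abs_mul]
        _ ≤ (1 + Hx) * D + (1 + Hx) * D :=
            add_le_add (mul_le_mul hpa' ha (abs_nonneg _) (by positivity))
              (mul_le_mul hqa' hb (abs_nonneg _) (by positivity))
        _ = D * (1 + Hx) + D * (1 + Hx) := by ring
    exact mul_le_mul (mul_le_mul_of_nonneg_right hχ₁b (by positivity)) hpq (abs_nonneg _) (by positivity)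
  have hin : |E * (χ₁ * (2 * T - p ^ 2 - q ^ 2) + χ₂ * T * (p ^ 2 + q ^ 2) / R) +
      χ₁ * (2 * T) * (p * a + q * b)| ≤
      |E| * (M₁ * (2 * T + p ^ 2 + q ^ 2) + M₂ * T * (p ^ 2 + q ^ 2)) +
        M₁ * (2 * T) * (D * (1 + Hx) + D * (1 + Hx)) := by
    calc _ ≤ |E * (χ₁ * (2 * T - p ^ 2 - q ^ 2) + χ₂ * T * (p ^ 2 + q ^ 2) / R)| +
          |χ₁ * (2 * T) * (p * a + q * b)| := abs_add_le _ _
      _ = |E| * |χ₁ * (2 * T - p ^ 2 - q ^ 2) + χ₂ * T * (p ^ 2 + q ^ 2) / R| +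
          |χ₁ * (2 * T) * (p * a + q * b)| := by rw [abs_mul]
      _ ≤ |E| * (|χ₁ * (2 * T - p ^ 2 - q ^ 2)| + |χ₂ * T * (p ^ 2 + q ^ 2) / R|) +
          |χ₁ * (2 * T) * (p * a + q * b)| := by
          gcongr
          exact abs_add_le _ _
      _ ≤ _ := by gcongr
  have hE' : |E| ≤ Ce * (1 + Hx) := hE
  have hpoly : |E| * (M₁ * (2 * T + p ^ 2 + q ^ 2) + M₂ * T * (p ^ 2 + q ^ 2)) +
      M₁ * (2 * T) * (D * (1 + Hx) + D * (1 + Hx)) ≤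
      (Ce * (M₁ * (2 * T + 4) + 4 * M₂ * T) + 4 * M₁ * T * D) * (1 + Hx) ^ 2 := by
    have hMT : 0 ≤ M₂ * T := mul_nonneg hM₂0 hT
    have hpq4 : p ^ 2 + q ^ 2 ≤ 4 * Hx := by linarith
    have s1 : M₁ * (2 * T + p ^ 2 + q ^ 2) + M₂ * T * (p ^ 2 + q ^ 2) ≤
        (M₁ * (2 * T + 4) + 4 * M₂ * T) * (1 + Hx) := by
      have a1 : M₁ * (p ^ 2 + q ^ 2) ≤ M₁ * (4 * Hx) := mul_le_mul_of_nonneg_left hpq4 hM₁0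
      have a2 : M₂ * T * (p ^ 2 + q ^ 2) ≤ M₂ * T * (4 * Hx) := mul_le_mul_of_nonneg_left hpq4 hMT
      have a3 : 0 ≤ M₁ * T * Hx := by positivity
      linarith
    have s2 : |E| * (M₁ * (2 * T + p ^ 2 + q ^ 2) + M₂ * T * (p ^ 2 + q ^ 2)) ≤
        (Ce * (1 + Hx)) * ((M₁ * (2 * T + 4) + 4 * M₂ * T) * (1 + Hx)) :=
      mul_le_mul hE' s1 (by positivity) (by positivity)
    have s3 : M₁ * (2 * T) * (D * (1 + Hx) + D * (1 + Hx)) ≤ 4 * M₁ * T * D * (1 + Hx) ^ 2 := by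
      have h0 : 0 ≤ 4 * M₁ * T * D * Hx * (1 + Hx) := by positivity
      linarith
    have e2 : (Ce * (1 + Hx)) * ((M₁ * (2 * T + 4) + 4 * M₂ * T) * (1 + Hx)) =
        Ce * (M₁ * (2 * T + 4) + 4 * M₂ * T) * (1 + Hx) ^ 2 := by ring
    linarith
  rw [key, abs_mul, abs_div, abs_of_nonneg hγ, abs_of_pos hR0]
  calc γ / R * |E * (χ₁ * (2 * T - p ^ 2 - q ^ 2) + χ₂ * T * (p ^ 2 + q ^ 2) / R) +
        χ₁ * (2 * T) * (p * a + q * b)|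
      ≤ γ / R * (|E| * (M₁ * (2 * T + p ^ 2 + q ^ 2) + M₂ * T * (p ^ 2 + q ^ 2)) +
          M₁ * (2 * T) * (D * (1 + Hx) + D * (1 + Hx))) :=
        mul_le_mul_of_nonneg_left hin (div_nonneg hγ hR0.le)
    _ ≤ γ / R * ((Ce * (M₁ * (2 * T + 4) + 4 * M₂ * T) + 4 * M₁ * T * D) * (1 + Hx) ^ 2) :=
        mul_le_mul_of_nonneg_left hpoly (div_nonneg hγ hR0.le)
    _ = γ * (Ce * (M₁ * (2 * T + 4) + 4 * M₂ * T) + 4 * M₁ * T * D) / R * (1 + Hx) ^ 2 := by ring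

end TruncError

/-! ### Dynkin's identity for an observable of linear energy growth -/

section Dynkin

variable {ω₂ lam β γ : ℝ} (hω : 0 < ω₂) (hl : 0 ≤ lam) (hβ : 0 < β) (hγ : 0 < γ) {n : ℕ} (hn : 0 < n)
  {T : ℝ} (hT : 0 < T)
include hω hl hβ hγ hn hT

/-- **Dynkin's identity for an observable of linear energy growth.** For the pinned chain (`ω₂, β, γ > 0`,
`lam ≥ 0`, `n ≥ 1`, equal bath temperatures `T > 0`), a `C²` observable `e` with `|e| ≤ C_e(1+H)`,
`|∂_{p₀} e|, |∂_{p_{n-1}} e| ≤ D` and generator image `L e = ℓ` with `|ℓ| ≤ B(1+H)²`: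
`P_r e(z) - e(z) = ∫₀ʳ P_s ℓ(z) ds` for the constructed transition kernels, all `r ≥ 0`, `z`. Proof: the
truncations `e χ(H/(n+1))` are `C²_c`, converge to `e` with generators converging to `ℓ`
(`pinnedChain_abs_generator_trunc_sub_le`), all dominated by `K e^{H/(2T)}`; conclude by
`pinnedChain_dynkin_of_truncation` (dominated convergence through CEHR (3.4)).
[cite: CuneoEckmannHairerReyBellet2018, §3 eq. (3.2)–(3.4)] -/
theorem pinnedChain_dynkin_of_linearGrowth {e ℓ : PhaseSpace n → ℝ} (he : ContDiff ℝ 2 e)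
    (hgen : ∀ x, (pinnedChain ω₂ lam β γ).generator n T T e x = ℓ x) {Ce D B : ℝ} (hCe : 0 ≤ Ce)
    (hD : 0 ≤ D) (hB : 0 ≤ B) (heb : ∀ y, |e y| ≤ Ce * (1 + (pinnedChain ω₂ lam β γ).hamiltonian n y))
    (hd0 : ∀ y, |partialP ⟨0, hn⟩ e y| ≤ D)
    (hdN : ∀ y, |partialP ⟨n - 1, Nat.sub_lt hn one_pos⟩ e y| ≤ D)
    (hℓb : ∀ y, |ℓ y| ≤ B * (1 + (pinnedChain ω₂ lam β γ).hamiltonian n y) ^ 2)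
    (r : ℝ≥0) (z : PhaseSpace n) :
    ∫ y, e y ∂((pinnedChain ω₂ lam β γ).transitionKernel n T T r z) - e z =
      ∫ s in (0 : ℝ)..(r : ℝ), ∫ y, ℓ y ∂((pinnedChain ω₂ lam β γ).transitionKernel n T T s.toNNReal z) := by
  -- the constants
  obtain ⟨A, hA0, hA⟩ := pinnedChain_abs_generator_trunc_sub_le hω.le hl hβ.le hγ.le hn hT.le he hCe hD heb hd0 hdN
  set θ : ℝ := 1 / (2 * T) with hθ
  have hθ0 : 0 < θ := by positivity
  have hθ1 : θ < 1 / T := by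
    rw [hθ, div_lt_div_iff₀ (by positivity) hT]; nlinarith
  set C₀ : ℝ := 2 * Real.exp θ / θ ^ 2 with hC₀
  have hC₀0 : 0 ≤ C₀ := by positivity
  -- the truncations
  set f : ℕ → PhaseSpace n → ℝ := fun k y =>
    e y * smoothCutoff ((pinnedChain ω₂ lam β γ).hamiltonian n y / (k + 1)) with hf
  have hfdef : ∀ k y, f k y = e y * smoothCutoff ((pinnedChain ω₂ lam β γ).hamiltonian n y / (k + 1)) :=
    fun k y => rfl
  have hU2 : ContDiff ℝ 2 (pinnedChain ω₂ lam β γ).U := pinnedChain_contDiff_U ω₂ lam β γ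
  have hV2 : ContDiff ℝ 2 (pinnedChain ω₂ lam β γ).V := pinnedChain_contDiff_V ω₂ lam β γ
  have hH2 : ContDiff ℝ 2 ((pinnedChain ω₂ lam β γ).hamiltonian n) :=
    (pinnedChain ω₂ lam β γ).contDiff_hamiltonian hU2 hV2 n
  have hH0 : ∀ y, 0 ≤ (pinnedChain ω₂ lam β γ).hamiltonian n y := fun y =>
    pinnedChain_hamiltonian_nonneg hω.le hl hβ.le γ n y
  have hRpos : ∀ k : ℕ, (0:ℝ) < k + 1 := fun k => by positivity
  have hR1 : ∀ k : ℕ, (1:ℝ) ≤ k + 1 := fun k => by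
    have : (0:ℝ) ≤ k := Nat.cast_nonneg k
    linarith
  have hf2 : ∀ k, ContDiff ℝ 2 (f k) := fun k =>
    he.mul ((contDiff_smoothCutoff (n := 2)).comp (hH2.div_const _))
  have hfs : ∀ k, HasCompactSupport (f k) := fun k => by
    refine HasCompactSupport.intro
      (pinnedChain_isCompact_setOf_hamiltonian_le hω hl hβ.le γ n (2 * (k + 1))) fun y hy => ?_
    simp only [mem_setOf_eq, not_le] at hy
    have h2 : 2 ≤ (pinnedChain ω₂ lam β γ).hamiltonian n y / (k + 1) := by
      rw [le_div_iff₀ (hRpos k)]; linarith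
    rw [hfdef, smoothCutoff_of_two_le h2, mul_zero]
  -- eventually the cutoff is `1`
  have hev : ∀ y, ∀ᶠ k : ℕ in atTop, smoothCutoff ((pinnedChain ω₂ lam β γ).hamiltonian n y / (k + 1)) = 1 := by
    intro y
    obtain ⟨k₀, hk₀⟩ := exists_nat_ge ((pinnedChain ω₂ lam β γ).hamiltonian n y)
    filter_upwards [eventually_ge_atTop k₀] with k hk
    have h1 : (pinnedChain ω₂ lam β γ).hamiltonian n y / (k + 1) ≤ 1 := by
      rw [div_le_one (hRpos k)]
      have : (k₀ : ℝ) ≤ k := by exact_mod_cast hk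
      linarith
    exact smoothCutoff_of_le_one h1
  -- size estimates
  have hsq : ∀ y, (1 + (pinnedChain ω₂ lam β γ).hamiltonian n y) ^ 2 ≤
      C₀ * Real.exp (θ * (pinnedChain ω₂ lam β γ).hamiltonian n y) := fun y => one_add_sq_le_exp (hH0 y) hθ0
  have he1 : ∀ y, |e y| ≤ Ce * (1 + (pinnedChain ω₂ lam β γ).hamiltonian n y) ^ 2 := fun y => by
    have h1 := heb y
    have h2 : Ce * (1 + (pinnedChain ω₂ lam β γ).hamiltonian n y) ≤
        Ce * (1 + (pinnedChain ω₂ lam β γ).hamiltonian n y) ^ 2 := by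
      refine mul_le_mul_of_nonneg_left ?_ hCe
      have := hH0 y
      nlinarith
    exact h1.trans h2
  -- the truncation error, with `Le = ℓ`
  have herr : ∀ (k : ℕ) (y : PhaseSpace n),
      |(pinnedChain ω₂ lam β γ).generator n T T (f k) y -
          smoothCutoff ((pinnedChain ω₂ lam β γ).hamiltonian n y / (k + 1)) * ℓ y| ≤
        A / (k + 1) * (1 + (pinnedChain ω₂ lam β γ).hamiltonian n y) ^ 2 := by
    intro k y
    have h := hA (k + 1) (hR1 k) y
    rw [hgen y] at h
    exact h
  -- the uniform exponential domination of `f_k` and `L f_k`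
  have hfb : ∀ (k : ℕ) (y : PhaseSpace n),
      |f k y| ≤ (A + B + Ce) * C₀ * Real.exp (θ * (pinnedChain ω₂ lam β γ).hamiltonian n y) := by
    intro k y
    have h1 := he1 y
    have hχ0 := smoothCutoff_nonneg ((pinnedChain ω₂ lam β γ).hamiltonian n y / (k + 1))
    have hχ1 := smoothCutoff_le_one ((pinnedChain ω₂ lam β γ).hamiltonian n y / (k + 1))
    have hs := hsq y
    rw [hfdef, abs_mul, abs_of_nonneg hχ0]
    generalize (pinnedChain ω₂ lam β γ).hamiltonian n y = Hy at h1 hs hχ0 hχ1 ⊢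
    generalize smoothCutoff (Hy / (k + 1)) = c at hχ0 hχ1 ⊢
    calc |e y| * c ≤ |e y| := mul_le_of_le_one_right (abs_nonneg _) hχ1
      _ ≤ Ce * (1 + Hy) ^ 2 := h1
      _ ≤ (A + B + Ce) * (1 + Hy) ^ 2 := by gcongr; linarith
      _ ≤ (A + B + Ce) * (C₀ * Real.exp (θ * Hy)) := by gcongr
      _ = (A + B + Ce) * C₀ * Real.exp (θ * Hy) := by ring
  have hLb : ∀ (k : ℕ) (y : PhaseSpace n), |(pinnedChain ω₂ lam β γ).generator n T T (f k) y| ≤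
      (A + B + Ce) * C₀ * Real.exp (θ * (pinnedChain ω₂ lam β γ).hamiltonian n y) := by
    intro k y
    have h1 := herr k y
    have h2 := hℓb y
    have hs := hsq y
    have hHy := hH0 y
    have hχ0 := smoothCutoff_nonneg ((pinnedChain ω₂ lam β γ).hamiltonian n y / (k + 1))
    have hχ1 := smoothCutoff_le_one ((pinnedChain ω₂ lam β γ).hamiltonian n y / (k + 1))
    generalize (pinnedChain ω₂ lam β γ).generator n T T (f k) y = G at h1 ⊢
    generalize (pinnedChain ω₂ lam β γ).hamiltonian n y = Hy at h1 h2 hs hHy hχ0 hχ1 ⊢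
    generalize smoothCutoff (Hy / (k + 1)) = c at hχ0 hχ1 h1 ⊢
    generalize ℓ y = l at h1 h2 ⊢
    have h3 : |c * l| ≤ B * (1 + Hy) ^ 2 := by
      rw [abs_mul, abs_of_nonneg hχ0]
      calc c * |l| ≤ 1 * |l| := mul_le_mul_of_nonneg_right hχ1 (abs_nonneg _)
        _ ≤ B * (1 + Hy) ^ 2 := by rw [one_mul]; exact h2
    have h4 : A / (k + 1) * (1 + Hy) ^ 2 ≤ A * (1 + Hy) ^ 2 :=
      mul_le_mul_of_nonneg_right (div_le_self hA0 (hR1 k)) (sq_nonneg _)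
    calc |G| ≤ |G - c * l| + |c * l| := by
          have := abs_add_le (G - c * l) (c * l); rwa [sub_add_cancel] at this
      _ ≤ A * (1 + Hy) ^ 2 + B * (1 + Hy) ^ 2 := add_le_add (h1.trans h4) h3
      _ ≤ (A + B + Ce) * (1 + Hy) ^ 2 := by nlinarith [sq_nonneg (1 + Hy)]
      _ ≤ (A + B + Ce) * (C₀ * Real.exp (θ * Hy)) := by gcongr
      _ = (A + B + Ce) * C₀ * Real.exp (θ * Hy) := by ring
  -- pointwise convergence of `f_k` and `L f_k`
  have hfe : ∀ y, Tendsto (fun k => f k y) atTop (𝓝 (e y)) := fun y => by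
    refine tendsto_const_nhds.congr' ?_
    filter_upwards [hev y] with k hk
    rw [hfdef, hk, mul_one]
  have hfℓ : ∀ y, Tendsto (fun k => (pinnedChain ω₂ lam β γ).generator n T T (f k) y) atTop (𝓝 (ℓ y)) := by
    intro y
    have hg : Tendsto (fun k : ℕ => smoothCutoff ((pinnedChain ω₂ lam β γ).hamiltonian n y / (k + 1)) * ℓ y)
        atTop (𝓝 (ℓ y)) := by
      refine tendsto_const_nhds.congr' ?_
      filter_upwards [hev y] with k hk
      rw [hk, one_mul]
    have hd : Tendsto (fun k : ℕ => (pinnedChain ω₂ lam β γ).generator n T T (f k) y -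
        smoothCutoff ((pinnedChain ω₂ lam β γ).hamiltonian n y / (k + 1)) * ℓ y) atTop (𝓝 0) := by
      have hCn : Tendsto (fun k : ℕ => A / (k + 1) * (1 + (pinnedChain ω₂ lam β γ).hamiltonian n y) ^ 2)
          atTop (𝓝 0) := by
        have h1 : Tendsto (fun k : ℕ => A / ((k : ℝ) + 1)) atTop (𝓝 0) :=
          tendsto_const_nhds.div_atTop (tendsto_natCast_atTop_atTop.atTop_add tendsto_const_nhds)
        simpa using h1.mul_const ((1 + (pinnedChain ω₂ lam β γ).hamiltonian n y) ^ 2)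
      exact squeeze_zero_norm (fun k => by rw [Real.norm_eq_abs]; exact herr k y) hCn
    have := hd.add hg
    simpa using this
  exact pinnedChain_dynkin_of_truncation hω hl hβ hγ hn hT hθ0 hθ1 f hf2 hfs hfe hfℓ hfb hLb r z

end Dynkin

/-! ### Duhamel's formula for the kick response (registered sub-goal `kickResp_duhamel`) -/

section Pairing

/-- **Duhamel's formula for the kick response (Dynkin paired with `p₀`).** For the `(N+1)`-site pinned chain
(`ω₂, β, γ, T > 0`, `lam ≥ 0`), a `C²` observable `e` with `|e| ≤ C_e(1+H)`, `|∂_{p₀} e|, |∂_{p_N} e| ≤ D`, and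
continuous generator image `L e = ℓ` with `|ℓ| ≤ B(1+H)²`, for every `t ≥ 0`:
`kickResp e t - ∫ p₀ e dμ_T = ∫₀ᵗ kickResp ℓ s ds`. Pointwise Dynkin (`pinnedChain_dynkin_of_linearGrowth`) paired
with `p₀ ∈ L²(μ_T)` under the `K_t`-invariant Gibbs law (`pinnedChain_integral_mul_act_sub_of_dynkin`,
`pinnedChain_gibbsMeasure_bind_transitionKernel`; `p₀, e, ℓ` are square-integrable as `O((1+H)²)` observables).
[folklore] -/
theorem kickResp_duhamel :
    ∀ (ω₂ lam β γ : ℝ), 0 < ω₂ → 0 ≤ lam → 0 < β → 0 < γ → ∀ (T : ℝ), 0 < T →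
      ∀ (N : ℕ) (e ℓ : PhaseSpace (N + 1) → ℝ), ContDiff ℝ 2 e → Continuous ℓ →
      (∀ z, (pinnedChain ω₂ lam β γ).generator (N + 1) T T e z = ℓ z) →
      ∀ (Ce D B : ℝ), 0 ≤ Ce → 0 ≤ D → 0 ≤ B →
      (∀ y, |e y| ≤ Ce * (1 + (pinnedChain ω₂ lam β γ).hamiltonian (N + 1) y)) →
      (∀ y, |partialP 0 e y| ≤ D) → (∀ y, |partialP (Fin.last N) e y| ≤ D) →
      (∀ y, |ℓ y| ≤ B * (1 + (pinnedChain ω₂ lam β γ).hamiltonian (N + 1) y) ^ 2) →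
      ∀ (t : ℝ), 0 ≤ t →
        kickResp ω₂ lam β γ T N e t - ∫ z, z.2 0 * e z ∂((pinnedChain ω₂ lam β γ).gibbsMeasure (N + 1) T) =
          ∫ s in (0 : ℝ)..t, kickResp ω₂ lam β γ T N ℓ s := by
  intro ω₂ lam β γ hω hl hβ hγ T hT N e ℓ he hℓ hgen Ce D B hCe hD hB heb hd0 hdN hℓb t ht
  have hN : 0 < N + 1 := Nat.succ_pos N
  haveI : IsProbabilityMeasure ((pinnedChain ω₂ lam β γ).gibbsMeasure (N + 1) T) :=
    pinnedChain_isProbabilityMeasure_gibbsMeasure hω hl hβ.le γ (N + 1) hT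
  have hinv : ∀ s : ℝ≥0, ((pinnedChain ω₂ lam β γ).gibbsMeasure (N + 1) T).bind
      ((pinnedChain ω₂ lam β γ).transitionKernel (N + 1) T T s) = (pinnedChain ω₂ lam β γ).gibbsMeasure (N + 1) T :=
    fun s => pinnedChain_gibbsMeasure_bind_transitionKernel hω hl hβ.le hγ.le hN hT s
  have hlast : (⟨N + 1 - 1, Nat.sub_lt hN one_pos⟩ : Fin (N + 1)) = Fin.last N := Fin.ext (by simp)
  have h0 : (⟨0, hN⟩ : Fin (N + 1)) = 0 := rfl
  have hd0' : ∀ y, |partialP ⟨0, hN⟩ e y| ≤ D := fun y => by rw [h0]; exact hd0 y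
  have hdN' : ∀ y, |partialP ⟨N + 1 - 1, Nat.sub_lt hN one_pos⟩ e y| ≤ D := fun y => by
    rw [hlast]; exact hdN y
  have hdyn := fun r z => pinnedChain_dynkin_of_linearGrowth hω hl hβ hγ hN hT he hgen hCe hD hB heb hd0' hdN'
    hℓb r z
  have hH0 : ∀ y, 0 ≤ (pinnedChain ω₂ lam β γ).hamiltonian (N + 1) y := fun y =>
    pinnedChain_hamiltonian_nonneg hω.le hl hβ.le γ (N + 1) y
  -- square integrability of `p₀`, `e`, `ℓ`
  have hf2 : Integrable (fun y : PhaseSpace (N + 1) => (y.2 0) ^ 2) ((pinnedChain ω₂ lam β γ).gibbsMeasure (N + 1) T) :=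
    pinnedChain_integrable_sq_of_abs_le hω hl hβ.le γ (N + 1) hT (by fun_prop) (C := 4) fun y => by
      simpa using pinnedChain_abs_momentum_pow_le hω.le hl hβ.le γ (N + 1) y 0 (k := 1) (by norm_num)
  have he2' : Integrable (fun y => e y ^ 2) ((pinnedChain ω₂ lam β γ).gibbsMeasure (N + 1) T) :=
    pinnedChain_integrable_sq_of_abs_le hω hl hβ.le γ (N + 1) hT he.continuous (C := Ce) fun y => by
      refine (heb y).trans (mul_le_mul_of_nonneg_left ?_ hCe)
      have := hH0 y
      nlinarith
  have hℓ2 : Integrable (fun y => ℓ y ^ 2) ((pinnedChain ω₂ lam β γ).gibbsMeasure (N + 1) T) :=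
    pinnedChain_integrable_sq_of_abs_le hω hl hβ.le γ (N + 1) hT hℓ (C := B) hℓb
  have hp0m : Measurable fun y : PhaseSpace (N + 1) => y.2 0 := by fun_prop
  have h := pinnedChain_integral_mul_act_sub_of_dynkin hω hl hβ.le hγ.le (N + 1) T T
    ((pinnedChain ω₂ lam β γ).gibbsMeasure (N + 1) T) hinv hp0m he.continuous.measurable hℓ.measurable hf2 he2'
    hℓ2 hdyn ht
  simpa only [kickResp] using h

end Pairing

end Summit.AtomisticToContinuum.FouriersLaw.Theorems.CoherentDephasing.MeanFieldDuhamel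

end
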